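import Summits.BirchSwinnertonDyer.BirchSwinnertonDyer.Theorems.ManinLocalTwoThreeEtaIdentityReductionTwentyFour
import Summits.BirchSwinnertonDyer.BirchSwinnertonDyer.Theorems.ManinLocalTwoThreeNeronSqueeze
import Summits.BirchSwinnertonDyer.Rank1Residual.Additive.IntModelConductorCertificate
import HarnessLib

/-!
# Level 24: the Néron squeeze for `24a1 = X₀(24)` — `Λ(φ₂₄) ⊆ Λ_Néron(24a1) ⟹ |c| = 1` on `X₀(24)`; `N(24a1) = 24` (kernel);
# the `X₀(24)`-domain of C2 is inhabited under the item's own modularity binder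

Cell bsd-f2-manin, route `ManinLocalTwoThree` (crux C2 `ManinOddAtFour` stmt-22967: `2² ∣ 24`), prover seat p2 gen 26 = the hand assigned
to -an g50's TURNKEY T-an-g50-24 (LEAD 14:39:09Z); level-`24` instance of p3 g23's general NÉRON SQUEEZE
`NeronSqueeze.abs_maninConstant_eq_one_of_periodLattice_le` (-an g50 MEMO-an §95), with the certificates of -an g50's
`Sketch-an-g50.lean` §5 (re-derived here def-free; the tree's `cuspFormEta24` is used instead of a new cusp-form definition).

* §1 `24a1 = [0, −1, 0, −4, 4]`: globally minimal (kernel minimality certificate), elliptic, **`N(24a1) = 24`** by the rank-2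
  observatory's kernel Tate certificates (`IntModelCond.conductorNorm_mk_eq_of_certs_of_eq`): at `2` the change `(r, s, t) = (0, 1, 2)`
  gives `[2, −2, 4, −8, 0]`, deep exit `I₁*` (`2 ∥ a₂`, `4 ∣ a₃` with `a₃/4` odd, `8 ∣ a₄`, `16 ∣ a₆`), `f₂ = 8 + 1 − 6 = 3`; at `3`
  multiplicative, `f₃ = 1`; Néron invariants `(g₂, g₃) = (c₄/12, c₆/216) = (52/3, −280/27)` (`isNeronLatticeOf_twentyFourA1_iff`).
* §2 **THE SQUEEZE at `24`**: (S2)₂₄ `Λ(φ₂₄) ⊆ Λ(52/3, −280/27)` ⟹ `|c(D)| = 1` for every globally minimal elliptic `W/ℚ` and every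
  `X₀(24)`-datum `D` of `W` with the lattice clause (`f_eq_eta24` pins `D.f = φ₂₄`; then p3's Néron squeeze with `W₀ = 24a1`); C2-shaped
  corollary `2 ∤ c`; and the versions from the three `q`-limits (T1)–(T3) of `EtaIdentityReductionTwentyFour`.
* §3 GIVEN THE ITEM'S OWN BINDER `exists_isNewformOf`: `24a1` has a newform in `S₂(Γ₀(24))`, it is `φ₂₄` (`aₙ(φ₂₄) = aₙ(24a1)`), and a
  lattice-optimal `X₀(24)`-datum on a global minimal model in the class `24a` exists — C2's `∀`-domain at `N = 24` is inhabited relative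
  to the item's hypotheses (a FACT-FREE `aₙ(φ₂₄) = aₙ(24a1)` would need the Eichler–Shimura relation at a non-CM level; not claimed).

HONEST FRAMING: §1–§2 unconditional given (S2)₂₄ / (T1)–(T3) as explicit hypotheses (discharged in the sequel
`…EtaIdentitiesTwentyFour`); §3 CONDITIONAL on `exists_isNewformOf`.  Nothing here proves C2 (all levels), Manin's conjecture or BSD.
No definition, no named fact, no sorry. [cite: SilvermanATAEC1994, IV.5.1, IV.6.1, Cor. IV.9.1] [cite: Silverman1994, IV.9.4, IV.11.1]
[cite: CremonaAlgorithms1997, Table 1 (24a1), Table 3] [cite: AgasheRibetStein2006, §§1–2] [cite: DiamondShurman2005, Thm. 8.8.3]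
-/

set_option autoImplicit false
-- lint-debt: the directory name repeats the summit name (sibling precedent `ManinLocalTwoThreeNeronSqueeze.lean`)
set_option linter.dupNamespace false

noncomputable section

open Complex Filter Topology Set Function
open UpperHalfPlane hiding I
open scoped Real Topology Manifold MatrixGroups ModularForm
open ModularForm CongruenceSubgroup WeierstrassCurve
open Summit.BirchSwinnertonDyer.BirchSwinnertonDyer.Rank2Observatory
open Summit.BirchSwinnertonDyer.BirchSwinnertonDyer.Rank2Observatory.RootNumber
open Summit.BirchSwinnertonDyer.BirchSwinnertonDyer.Rank2Observatory.Tate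
open Summit.BirchSwinnertonDyer.Rank1Residual.Additive
open Literature.NumberTheory.EllipticCurves Literature.NumberTheory.EllipticCurves.ModularForms
open Literature.NumberTheory.Automorphic

namespace Summit.BirchSwinnertonDyer.BirchSwinnertonDyer.Theorems.ManinLocalTwoThree.LevelTwentyFour

open EtaIdentityReductionTwentyFour

/-! ## §1 `24a1 = [0, −1, 0, −4, 4]`: minimality, conductor `24`, Néron invariants `(52/3, −280/27)` -/

/-- The literal `ℚ`-model `[0, −1, 0, −4, 4]` read through integer casts. [folklore] -/
theorem mk_twentyFourA1_eq_cast :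
    (⟨0, -1, 0, -4, 4⟩ : WeierstrassCurve ℚ) = ⟨((0 : ℤ) : ℚ), ((-1 : ℤ) : ℚ), ((0 : ℤ) : ℚ), ((-4 : ℤ) : ℚ), ((4 : ℤ) : ℚ)⟩ := by
  ext <;> norm_num

/-- `24a1 = [0, −1, 0, −4, 4]` is globally minimal (`Δ = 2⁸3²`, `v₂(Δ) = 8 < 12`, `3 ∤ c₄ = 208`; kernel certificate, as in -an g50 §5).
[cite: SilvermanAEC2009, VII.1 Remark 1.1] [cite: CremonaAlgorithms1997, Table 1 (24a1)] -/
theorem isGloballyMinimal_twentyFourA1 : (⟨0, -1, 0, -4, 4⟩ : WeierstrassCurve ℚ).IsGloballyMinimal := by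
  rw [mk_twentyFourA1_eq_cast]
  exact IntModelCond.isGloballyMinimal_mk_of_minCheck 0 (-1) 0 (-4) 4 (cm := ⟨8, 4, 6, [⟨3, 1, 2, 0, 0⟩]⟩) (by decide +kernel)

/-- `24a1` is an elliptic curve (`Δ = 2304 ≠ 0`); a theorem, use `haveI`. [folklore] -/
theorem isElliptic_twentyFourA1 : (⟨0, -1, 0, -4, 4⟩ : WeierstrassCurve ℚ).IsElliptic :=
  ⟨by norm_num [WeierstrassCurve.Δ, WeierstrassCurve.b₂, WeierstrassCurve.b₄, WeierstrassCurve.b₆, WeierstrassCurve.b₈]⟩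

/-- **`N(24a1) = 24 = 2³·3`**: Tate certificate at `2` = change `(r, s, t) = (0, 1, 2)` to `[2, −2, 4, −8, 0]`, deep exit `I₁*`
(`f₂ = v₂(Δ) + 1 − 6 = 3`); multiplicative at `3` (`f₃ = 1`).  NO named fact. [cite: Silverman1994, IV.9.4 Step 7 and IV.11.1]
[cite: CremonaAlgorithms1997, Table 1 (24a1)] -/
theorem conductorNorm_twentyFourA1 : (⟨0, -1, 0, -4, 4⟩ : WeierstrassCurve ℚ).conductorNorm ℤ = 24 := by
  rw [mk_twentyFourA1_eq_cast]
  exact IntModelCond.conductorNorm_mk_eq_of_certs_of_eq 0 (-1) 0 (-4) 4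
    (cm := ⟨8, 4, 6, [⟨3, 1, 2, 0, 0⟩]⟩) (c := ⟨8, 4, 6, 2, 0, 0, []⟩)
    (l₂ := ⟨3, 0, 1, 2, 8, 71, 0⟩) (l₃ := ⟨1, 0, 0, 0, 0, 0, 0⟩)
    (by decide +kernel) (by decide +kernel) (by decide +kernel) (by decide +kernel) (by decide +kernel)

/-- `2² ∣ 24`: the level `24` lies in C2's `4 ∣ N` world. [folklore] -/
theorem two_sq_dvd_twentyFour : 2 ^ 2 ∣ 24 := ⟨6, by norm_num⟩

/-- **The Néron invariants of `24a1`**: `c₄ = 208`, `c₆ = −2240`, so `IsNeronLatticeOf (24a1/ℂ) L ⟺ (g₂(L), g₃(L)) = (52/3, −280/27)`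
(as in -an g50 §5). [cite: CremonaAlgorithms1997, Table 1 (24a1)] [cite: SilvermanAEC2009, VI.5.1] -/
theorem isNeronLatticeOf_twentyFourA1_iff (L : PeriodPair) :
    IsNeronLatticeOf ((⟨0, -1, 0, -4, 4⟩ : WeierstrassCurve ℚ).baseChange ℂ) L ↔ L.g₂ = 52 / 3 ∧ L.g₃ = -(280 / 27) := by
  have h4 : ((⟨0, -1, 0, -4, 4⟩ : WeierstrassCurve ℚ).baseChange ℂ).c₄ = (((⟨0, -1, 0, -4, 4⟩ : WeierstrassCurve ℚ).c₄ : ℚ) : ℂ) := by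
    simp [WeierstrassCurve.baseChange, WeierstrassCurve.map_c₄]
  have h6 : ((⟨0, -1, 0, -4, 4⟩ : WeierstrassCurve ℚ).baseChange ℂ).c₆ = (((⟨0, -1, 0, -4, 4⟩ : WeierstrassCurve ℚ).c₆ : ℚ) : ℂ) := by
    simp [WeierstrassCurve.baseChange, WeierstrassCurve.map_c₆]
  have h4' : (⟨0, -1, 0, -4, 4⟩ : WeierstrassCurve ℚ).c₄ = 208 := by
    norm_num [WeierstrassCurve.c₄, WeierstrassCurve.b₂, WeierstrassCurve.b₄]
  have h6' : (⟨0, -1, 0, -4, 4⟩ : WeierstrassCurve ℚ).c₆ = -2240 := by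
    norm_num [WeierstrassCurve.c₆, WeierstrassCurve.b₂, WeierstrassCurve.b₄, WeierstrassCurve.b₆]
  rw [IsNeronLatticeOf, h4, h6, h4', h6']
  push_cast
  constructor
  · rintro ⟨ha, hb⟩; exact ⟨by rw [ha]; norm_num, by rw [hb]; norm_num⟩
  · rintro ⟨ha, hb⟩; exact ⟨by rw [ha]; norm_num, by rw [hb]; norm_num⟩

/-! ## §2 The Néron squeeze at `24`: (S2)₂₄ ⟹ `|c| = 1` on `X₀(24)` -/

/-- **(S2)₂₄ ⟹ `|c| = 1` on `X₀(24)`** (p3's `NeronSqueeze.abs_maninConstant_eq_one_of_periodLattice_le` with `W₀ = 24a1`, after pinning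
`D.f = φ₂₄`): for every globally minimal elliptic `W/ℚ` and every `X₀(24)`-datum `D` of `W` with the lattice clause.  No CM, no modularity
binder, no CDT, no printed Manin fact. [cite: SilvermanATAEC1994, IV.5.1, IV.6.1, Cor. IV.9.1] [cite: AgasheRibetStein2006, §§1–2] -/
theorem abs_maninConstant_eq_one_twentyFour_of_periodLattice_le
    (hS2 : ∃ L₁ : PeriodPair, L₁.g₂ = 52 / 3 ∧ L₁.g₃ = -(280 / 27) ∧ ∀ z ∈ periodLattice cuspFormEta24, z ∈ L₁.lattice)
    (W : WeierstrassCurve ℚ) [W.IsElliptic] [W.IsGloballyMinimal] (D : ModularParametrizationData W 24)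
    (hopt : ∀ z ∈ D.L.lattice, ∃ w ∈ periodLattice D.f, z = D.c * w) :
    |D.maninConstant| = 1 := by
  haveI := isElliptic_twentyFourA1
  haveI := isGloballyMinimal_twentyFourA1
  obtain ⟨L₁, h2, h3, hle⟩ := hS2
  refine NeronSqueeze.abs_maninConstant_eq_one_of_periodLattice_le (⟨0, -1, 0, -4, 4⟩ : WeierstrassCurve ℚ) L₁
    ((isNeronLatticeOf_twentyFourA1_iff L₁).mpr ⟨h2, h3⟩) W D (fun z hz ↦ hle z ?_) hopt
  rwa [f_eq_eta24 D] at hz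

/-- C2 `ManinOddAtFour` at `N = 24` (`2² ∣ 24`), modulo (S2)₂₄: `2 ∤ c(D)`. [folklore] -/
theorem not_two_dvd_maninConstant_twentyFour_of_periodLattice_le
    (hS2 : ∃ L₁ : PeriodPair, L₁.g₂ = 52 / 3 ∧ L₁.g₃ = -(280 / 27) ∧ ∀ z ∈ periodLattice cuspFormEta24, z ∈ L₁.lattice)
    (W : WeierstrassCurve ℚ) [W.IsElliptic] [W.IsGloballyMinimal] (D : ModularParametrizationData W 24)
    (hopt : ∀ z ∈ D.L.lattice, ∃ w ∈ periodLattice D.f, z = D.c * w) :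
    ¬ (2 : ℤ) ∣ D.maninConstant := by
  have h := abs_maninConstant_eq_one_twentyFour_of_periodLattice_le hS2 W D hopt
  intro h2
  have := Int.le_of_dvd (by rw [h]; norm_num) ((dvd_abs _ _).mpr h2)
  rw [h] at this
  norm_num at this

/-- **`|c| = 1` on `X₀(24)` from the three `q`-limits (T1)–(T3)** (`EtaIdentityReductionTwentyFour.periodLatticeLe24_of_etaIdentities` + the
squeeze). [cite: Ligozat1975, Ch. 4] [cite: SilvermanATAEC1994, IV.5.1] -/
theorem abs_maninConstant_eq_one_twentyFour_of_tendsto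
    (hT1 : Tendsto (fun τ : ℍ ↦ ((2 * π * I)⁻¹
      * deriv (etaQuotient 24 (expFn [(2, -1), (6, 3), (8, 1), (24, -3)]) ∘ ofComplex) τ
      + cuspFormEta24 τ * (2 * etaQuotient 24 (expFn [(2, -1), (4, 1), (6, -1), (8, 2), (12, 5), (24, -6)]) τ))
      / Function.Periodic.qParam 1 (τ : ℂ)) atImInfty (𝓝 0))
    (hT2 : Tendsto (fun τ : ℍ ↦ ((2 * π * I)⁻¹
      * deriv (etaQuotient 24 (expFn [(2, -1), (4, 1), (6, -1), (8, 2), (12, 5), (24, -6)]) ∘ ofComplex) τ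
      + cuspFormEta24 τ * (3 * etaQuotient 24 (expFn [(2, -1), (6, 3), (8, 1), (24, -3)]) τ ^ 2
        - 2 * etaQuotient 24 (expFn [(2, -1), (6, 3), (8, 1), (24, -3)]) τ - 4))
      / Function.Periodic.qParam 1 (τ : ℂ)) atImInfty (𝓝 0))
    (hT3 : Tendsto (fun τ : ℍ ↦ etaQuotient 24 (expFn [(2, -1), (6, 3), (8, 1), (24, -3)]) τ ^ 3
      - etaQuotient 24 (expFn [(2, -1), (6, 3), (8, 1), (24, -3)]) τ ^ 2
      - 4 * etaQuotient 24 (expFn [(2, -1), (6, 3), (8, 1), (24, -3)]) τ + 4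
      - etaQuotient 24 (expFn [(2, -1), (4, 1), (6, -1), (8, 2), (12, 5), (24, -6)]) τ ^ 2) atImInfty (𝓝 0))
    (W : WeierstrassCurve ℚ) [W.IsElliptic] [W.IsGloballyMinimal] (D : ModularParametrizationData W 24)
    (hopt : ∀ z ∈ D.L.lattice, ∃ w ∈ periodLattice D.f, z = D.c * w) :
    |D.maninConstant| = 1 :=
  abs_maninConstant_eq_one_twentyFour_of_periodLattice_le
    (periodLatticeLe24_of_etaIdentities (cubic24_of_deriv (deriv_x24_of_tendsto hT1) (deriv_y24_of_tendsto hT2) hT3)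
      (deriv_x24_of_tendsto hT1)) W D hopt

/-! ## §3 C2's `∀`-domain at `N = 24` is inhabited, GIVEN the item's own binder `exists_isNewformOf` -/

/-- **Modularity at `24a1`, levelled**: under `exists_isNewformOf` the curve `24a1` has a newform in `S₂(Γ₀(24))` (its conductor IS `24`, §1).
CONDITIONAL on modularity. [cite: DiamondShurman2005, Thm. 8.8.3] -/
theorem exists_isNewformOf_twentyFourA1 (hnf : exists_isNewformOf) :
    ∃ f : CuspForm (Gamma0 24) 2, IsNewformOf (⟨0, -1, 0, -4, 4⟩ : WeierstrassCurve ℚ) f := by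
  haveI := isElliptic_twentyFourA1
  have key : ∀ (N : ℕ) [NeZero N], (⟨0, -1, 0, -4, 4⟩ : WeierstrassCurve ℚ).conductorNorm ℤ = N →
      ∃ f : CuspForm (Gamma0 N) 2, IsNewformOf (⟨0, -1, 0, -4, 4⟩ : WeierstrassCurve ℚ) f := by
    intro N _ hN
    subst hN
    exact hnf _
  haveI : NeZero (24 : ℕ) := ⟨by decide⟩
  exact key 24 conductorNorm_twentyFourA1

/-- Under modularity the newform of `24a1` IS `φ₂₄`: `aₙ(η(2τ)η(4τ)η(6τ)η(12τ)) = aₙ(24a1)` for all `n`.  CONDITIONAL on `exists_isNewformOf`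
(no CM at `24`: a fact-free proof is not claimed). [cite: CremonaAlgorithms1997, Table 3 (N = 24)] -/
theorem cuspCoeff_eta24_eq_lFunction_twentyFourA1_of_modularity (hnf : exists_isNewformOf) (n : ℕ) :
    cuspCoeff cuspFormEta24 n = ((⟨0, -1, 0, -4, 4⟩ : WeierstrassCurve ℚ).LFunction n : ℂ) := by
  obtain ⟨f, hf⟩ := exists_isNewformOf_twentyFourA1 hnf
  rw [← eq_eta24_of_isNewform0 hf.1]
  exact hf.2 n

/-- **A lattice-optimal `X₀(24)`-datum on a global minimal model in the class `24a` exists under modularity** (Literature's fact-free datum package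
+ p2 g24's unconditional EXO), i.e. C2's `∀`-domain at `N = 24` is inhabited relative to the item's hypotheses.  CONDITIONAL on
`exists_isNewformOf` only. [cite: EdixhovenManin1991, Prop. 2] [cite: DiamondShurman2005, Thm. 8.8.3] -/
theorem maninOddAtFour_domain_inhabited_twentyFour_of_modularity (hnf : exists_isNewformOf) :
    ∃ (W₀ : WeierstrassCurve ℚ) (_ : W₀.IsElliptic) (_ : W₀.IsGloballyMinimal) (D₀ : ModularParametrizationData W₀ 24),
      (⟨0, -1, 0, -4, 4⟩ : WeierstrassCurve ℚ).IsIsogenous W₀ ∧ (∀ z ∈ D₀.L.lattice, ∃ w ∈ periodLattice D₀.f, z = D₀.c * w) ∧ 2 ^ 2 ∣ 24 := by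
  haveI := isElliptic_twentyFourA1
  haveI : NeZero (24 : ℕ) := ⟨by decide⟩
  obtain ⟨f, hf⟩ := exists_isNewformOf_twentyFourA1 hnf
  obtain ⟨D⟩ := nonempty_modularParametrizationData_of_isNewformOf hf
  obtain ⟨W₀, h₀, hmin, D₀, -, hiso, hopt, -⟩ :=
    ExistsMinimalOptimalDatum.existsMinimalOptimalDatum_full (⟨0, -1, 0, -4, 4⟩ : WeierstrassCurve ℚ) D
  exact ⟨W₀, h₀, hmin, D₀, hiso, hopt, two_sq_dvd_twentyFour⟩

end Summit.BirchSwinnertonDyer.BirchSwinnertonDyer.Theorems.ManinLocalTwoThree.LevelTwentyFour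

end
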